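import Literature.NumberTheory.LFunctions.AndersonStarkFresnel
import Literature.NumberTheory.LFunctions.AndersonStarkCoeffLSeries
import HarnessLib

/-!
# Anderson–Stark's coefficients `c_n` (`ζ(2s−1)/ζ(s) = ∑ c_n n^{-s}`) and the series (17) for Fawaz's `I(x)`

Topic `Literature/NumberTheory/LFunctions`. Everything in this file is PROVED (no definitions).
Companion of `AndersonStarkFresnel.lean` (the kernel `k(y) = 2[C(√y)+S(√y)−1]`, `fawazKernel`) for
the analysis of Fawaz's series (17) defining `fawazI` (`AndersonStarkLiouville.lean`):

* `summable_abs_andersonStarkCoeff_div_rpow_of_one_lt` — `∑ |c_n| n^{-σ} < ∞` for `σ > 1`, the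
  real form of the absolute convergence of the tree's `∑ c_n n^{-s} = ζ(2s−1)/ζ(s)`
  (`LSeriesHasSum_andersonStarkCoeff`, `AndersonStarkCoeffLSeries.lean`; the tree's
  `summable_abs_andersonStarkCoeff_div_rpow` of `AndersonStarkLiouvilleProofs.lean` is `σ = 3/2`).
* `fawazI_eq_tsum_fawazKernel` — (17) in kernel form, `I(x) = 1 + ∑_{n≥1} (c_n/n) k(nx)`;
  `summable_fawazI_term`; the bounds `abs_fawazI_sub_one_le`:
  `|I(x) − 1| ≤ 10 x^{-d} ∑ |c_n| n^{-1-d}` (`0 < d ≤ ½`), i.e. `O(x^{-1/2})` at `∞` and `O(x^{-d})`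
  at `0⁺` (Anderson–Stark after (19): "`I(x) = O(log²(1/x))` as `x → 0⁺` without any hypothesis at
  all"; any `x^{-d}` suffices for the Mellin strip).
* `continuousOn_fawazI` — `I` is continuous on `(0, ∞)` (uniform convergence on `[a, ∞)`).
* `mellinConvergent_fawazI_sub_one` — the Mellin transform of `I − 1` converges absolutely for
  `0 < Re s < ½` (Anderson–Stark: the transform of `h` "converges absolutely in the strip
  `−½ < Re(s) < 0`", their `s` being our `−s`).

## References

* [AndersonStark1981] R. J. Anderson, H. M. Stark, *Oscillation theorems*, in: Analytic Number
  Theory (Philadelphia 1980), LNM 899, Springer 1981, 79–106 — §4 (17)–(19) (read in the LNM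
  volume, `lit read book:editornd-analytic-number-theory`).
-/

noncomputable section

open Complex Filter MeasureTheory Set Asymptotics ArithmeticFunction
open scoped Real Topology ArithmeticFunction.Moebius ArithmeticFunction.zeta LSeries.notation

namespace Literature.NumberTheory.LFunctions

/-! ## Absolute convergence of `∑ c_n n^{-s}` in real form -/

/-- The real form of the absolute convergence: `∑_{n ≥ 1} |c_n| n^{-σ} < ∞` for `σ > 1`.
[folklore] -/
theorem summable_abs_andersonStarkCoeff_div_rpow_of_one_lt {σ : ℝ} (hσ : 1 < σ) :
    Summable fun n : ℕ ↦ |(andersonStarkCoeff n : ℝ)| / (n : ℝ) ^ σ := by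
  have h := ((LSeriesHasSum_andersonStarkCoeff (w := σ) (by simpa using hσ)).LSeriesSummable).norm
  refine (h.congr fun n ↦ ?_)
  rw [LSeries.norm_term_eq]
  rcases eq_or_ne n 0 with rfl | hn
  · simp [Real.zero_rpow (by linarith : σ ≠ 0)]
  · rw [if_neg hn, Complex.norm_intCast, Complex.ofReal_re]

/-- Shifted form: `∑_{n ≥ 0} |c_{n+1}| (n+1)^{-σ} < ∞` for `σ > 1`. [folklore] -/
theorem summable_abs_andersonStarkCoeff_succ_div_rpow {σ : ℝ} (hσ : 1 < σ) :
    Summable fun n : ℕ ↦ |(andersonStarkCoeff (n + 1) : ℝ)| / ((n : ℝ) + 1) ^ σ := by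
  have h := (summable_nat_add_iff 1).2 (summable_abs_andersonStarkCoeff_div_rpow_of_one_lt hσ)
  refine h.congr fun n ↦ ?_
  push_cast
  rfl

/-! ## The kernel bound interpolated: `|k(y)| ≤ 10 y^{-d}` for `0 ≤ d ≤ ½` -/

/-- `|k(y)| ≤ 10 y^{-d}` for `y > 0` and `0 ≤ d ≤ ½` (`|k| ≤ 10` on `(0,1]`, `|k| ≤ 4√2/(π√y)` on
`[1,∞)`). [folklore] -/
theorem abs_fawazKernel_le_rpow {y d : ℝ} (hy : 0 < y) (hd0 : 0 ≤ d) (hd : d ≤ 1 / 2) :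
    |fawazKernel y| ≤ 10 * y ^ (-d) := by
  rcases le_or_gt y 1 with h1 | h1
  · have hpow : 1 ≤ y ^ (-d) := by
      rw [Real.rpow_neg hy.le]
      exact one_le_inv_iff₀.2 ⟨Real.rpow_pos_of_pos hy _, Real.rpow_le_one hy.le h1 hd0⟩
    linarith [abs_fawazKernel_le_ten y]
  · have h := abs_fawazKernel_le hy
    have hc : 4 * Real.sqrt 2 / π ≤ 10 := by
      have hs2 : Real.sqrt 2 < 3 / 2 := (Real.sqrt_lt' (by norm_num)).mpr (by norm_num)
      rw [div_le_iff₀ Real.pi_pos]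
      nlinarith [Real.pi_gt_three]
    have hpow : 1 / Real.sqrt y ≤ y ^ (-d) := by
      rw [Real.sqrt_eq_rpow, Real.rpow_neg hy.le, one_div]
      apply inv_anti₀ (Real.rpow_pos_of_pos hy _)
      exact Real.rpow_le_rpow_of_exponent_le h1.le hd
    calc |fawazKernel y| ≤ 4 * Real.sqrt 2 / (π * Real.sqrt y) := h
      _ = (4 * Real.sqrt 2 / π) * (1 / Real.sqrt y) := by
          field_simp
      _ ≤ 10 * y ^ (-d) := mul_le_mul hc hpow (by positivity) (by norm_num)

/-! ## Fawaz's series (17): `I(x) = 1 + ∑_{n ≥ 1} (c_n/n) k(nx)` -/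

/-- **(17) in kernel form**: `I(x) = 1 + ∑_{n ≥ 1} (c_n/n) k(nx)` with `k(y) = 2[C(√y) + S(√y) − 1]`
(`fawazKernel`); the sum runs over `n : ℕ` with `n+1` in place of `n`. [cite: AndersonStark1981, §4 (17)] -/
theorem fawazI_eq_tsum_fawazKernel (x : ℝ) :
    fawazI x = 1 + ∑' n : ℕ, (andersonStarkCoeff (n + 1) : ℝ) / ((n : ℝ) + 1) *
      fawazKernel (((n : ℝ) + 1) * x) := by
  unfold fawazI
  congr 1
  rw [← tsum_mul_left]
  refine tsum_congr fun n ↦ ?_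
  rw [fawazKernel_apply]
  ring

/-- The terms of (17) are dominated: for `x > 0`, `0 ≤ d ≤ ½`,
`|(c_n/n) k(nx)| ≤ 10 x^{-d} · |c_n| n^{-(1+d)}`. [folklore] -/
theorem abs_fawazI_term_le {x d : ℝ} (hx : 0 < x) (hd0 : 0 ≤ d) (hd : d ≤ 1 / 2) (n : ℕ) :
    |(andersonStarkCoeff (n + 1) : ℝ) / ((n : ℝ) + 1) * fawazKernel (((n : ℝ) + 1) * x)| ≤
      10 * x ^ (-d) * (|(andersonStarkCoeff (n + 1) : ℝ)| / ((n : ℝ) + 1) ^ (1 + d)) := by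
  have hn : (0 : ℝ) < (n : ℝ) + 1 := by positivity
  have hk := abs_fawazKernel_le_rpow (mul_pos hn hx) hd0 hd
  rw [abs_mul, abs_div, abs_of_pos hn]
  rw [Real.mul_rpow hn.le hx.le] at hk
  have hsplit : ((n : ℝ) + 1) ^ (1 + d) = ((n : ℝ) + 1) * ((n : ℝ) + 1) ^ d := by
    rw [Real.rpow_add hn, Real.rpow_one]
  rw [hsplit]
  have hnd : ((n : ℝ) + 1) ^ (-d) = (((n : ℝ) + 1) ^ d)⁻¹ := Real.rpow_neg hn.le d
  rw [hnd] at hk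
  have hpos : 0 < ((n : ℝ) + 1) ^ d := Real.rpow_pos_of_pos hn _
  calc |(andersonStarkCoeff (n + 1) : ℝ)| / ((n : ℝ) + 1) * |fawazKernel (((n : ℝ) + 1) * x)|
      ≤ |(andersonStarkCoeff (n + 1) : ℝ)| / ((n : ℝ) + 1) * (10 * ((((n : ℝ) + 1) ^ d)⁻¹ * x ^ (-d))) :=
        mul_le_mul_of_nonneg_left hk (by positivity)
    _ = 10 * x ^ (-d) * (|(andersonStarkCoeff (n + 1) : ℝ)| / (((n : ℝ) + 1) * ((n : ℝ) + 1) ^ d)) := by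
        field_simp

/-- **Absolute convergence of (17)** for `x > 0`. [cite: AndersonStark1981, §4 (17) ("absolutely convergent")] -/
theorem summable_fawazI_term {x : ℝ} (hx : 0 < x) :
    Summable fun n : ℕ ↦ (andersonStarkCoeff (n + 1) : ℝ) / ((n : ℝ) + 1) *
      fawazKernel (((n : ℝ) + 1) * x) := by
  refine Summable.of_norm_bounded ((summable_abs_andersonStarkCoeff_succ_div_rpow
    (σ := 1 + 1 / 2) (by norm_num)).mul_left (10 * x ^ (-(1 / 2 : ℝ)))) fun n ↦ ?_
  rw [Real.norm_eq_abs]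
  exact abs_fawazI_term_le hx (by norm_num) le_rfl n

/-- **`|I(x) − 1| ≤ 10 x^{-d} ∑_{n ≥ 1} |c_n| n^{-(1+d)}`** for `x > 0`, `0 < d ≤ ½`: with `d = ½` a
form of Anderson–Stark's (18) (constant `10` for `4√2/π`), with small `d` the bound near `x = 0`
that makes the Mellin transform of `I − 1` converge on `−½ < Re w < 0` ((19) ff.: "`I(x) =
O(log²(1/x))` as `x → 0⁺` without any hypothesis at all"). [cite: AndersonStark1981, §4 (18)–(19)] -/
theorem abs_fawazI_sub_one_le {x d : ℝ} (hx : 0 < x) (hd0 : 0 < d) (hd : d ≤ 1 / 2) :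
    |fawazI x - 1| ≤ 10 * x ^ (-d) *
      ∑' n : ℕ, |(andersonStarkCoeff (n + 1) : ℝ)| / ((n : ℝ) + 1) ^ (1 + d) := by
  rw [fawazI_eq_tsum_fawazKernel, add_sub_cancel_left]
  have hs := summable_abs_andersonStarkCoeff_succ_div_rpow (σ := 1 + d) (by linarith)
  rw [← tsum_mul_left]
  have h1 := norm_tsum_le_tsum_norm (summable_fawazI_term hx).norm
  rw [Real.norm_eq_abs] at h1
  refine h1.trans ?_
  refine Summable.tsum_le_tsum (fun n ↦ ?_) (summable_fawazI_term hx).norm (hs.mul_left _)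
  rw [Real.norm_eq_abs]
  exact abs_fawazI_term_le hx hd0.le hd n

/-- `I(x) − 1 = O(x^{-1/2})` as `x → ∞`. [cite: AndersonStark1981, §4 (18)] -/
theorem fawazI_sub_one_isBigO_atTop :
    (fun x : ℝ ↦ fawazI x - 1) =O[atTop] fun x : ℝ ↦ x ^ (-(1 / 2 : ℝ)) := by
  set S : ℝ := ∑' n : ℕ, |(andersonStarkCoeff (n + 1) : ℝ)| / ((n : ℝ) + 1) ^ (1 + (1 / 2 : ℝ)) with hS
  refine IsBigO.of_bound (10 * S) ?_
  filter_upwards [eventually_gt_atTop 0] with x hx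
  rw [Real.norm_eq_abs, Real.norm_eq_abs, abs_of_pos (Real.rpow_pos_of_pos hx _),
    show 10 * S * x ^ (-(1 / 2 : ℝ)) = 10 * x ^ (-(1 / 2 : ℝ)) * S by ring]
  exact abs_fawazI_sub_one_le hx (by norm_num : (0 : ℝ) < 1 / 2) le_rfl

/-- `I(x) − 1 = O(x^{-d})` as `x → 0⁺`, for every `0 < d ≤ ½`. [cite: AndersonStark1981, §4 (after (19))] -/
theorem fawazI_sub_one_isBigO_nhds_zero {d : ℝ} (hd0 : 0 < d) (hd : d ≤ 1 / 2) :
    (fun x : ℝ ↦ fawazI x - 1) =O[𝓝[>] 0] fun x : ℝ ↦ x ^ (-d) := by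
  set S : ℝ := ∑' n : ℕ, |(andersonStarkCoeff (n + 1) : ℝ)| / ((n : ℝ) + 1) ^ (1 + d) with hS
  refine IsBigO.of_bound (10 * S) ?_
  filter_upwards [self_mem_nhdsWithin] with x hx
  rw [Real.norm_eq_abs, Real.norm_eq_abs, abs_of_pos (Real.rpow_pos_of_pos hx _),
    show 10 * S * x ^ (-d) = 10 * x ^ (-d) * S by ring]
  exact abs_fawazI_sub_one_le hx hd0 hd

/-- **`I` is continuous on `(0, ∞)`** (uniform convergence of (17) on `[a, ∞)`, `a > 0`).
[cite: AndersonStark1981, §4 (17)] -/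
theorem continuousOn_fawazI : ContinuousOn fawazI (Set.Ioi 0) := by
  intro x₀ hx₀
  have ha : (0 : ℝ) < x₀ / 2 := by simp at hx₀; linarith
  -- uniform convergence on `[x₀/2, ∞)`
  have hcont : ContinuousOn (fun x : ℝ ↦ 1 + ∑' n : ℕ, (andersonStarkCoeff (n + 1) : ℝ) / ((n : ℝ) + 1) *
      fawazKernel (((n : ℝ) + 1) * x)) (Set.Ici (x₀ / 2)) := by
    refine continuousOn_const.add ?_
    refine continuousOn_tsum (fun n ↦ ?_) ((summable_abs_andersonStarkCoeff_succ_div_rpow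
      (σ := 1 + 1 / 2) (by norm_num)).mul_left (10 * (x₀ / 2) ^ (-(1 / 2 : ℝ)))) (fun n x hxm ↦ ?_)
    · exact (continuous_const.mul (continuous_fawazKernel.comp (continuous_const.mul continuous_id))).continuousOn
    · have hx : 0 < x := lt_of_lt_of_le ha hxm
      rw [Real.norm_eq_abs]
      refine (abs_fawazI_term_le hx (by norm_num) le_rfl n).trans ?_
      refine mul_le_mul_of_nonneg_right ?_ (by positivity)
      refine mul_le_mul_of_nonneg_left ?_ (by norm_num)
      rw [Real.rpow_neg hx.le, Real.rpow_neg ha.le]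
      exact inv_anti₀ (Real.rpow_pos_of_pos ha _) (Real.rpow_le_rpow ha.le hxm (by norm_num))
  have heq : Set.EqOn fawazI (fun x : ℝ ↦ 1 + ∑' n : ℕ, (andersonStarkCoeff (n + 1) : ℝ) / ((n : ℝ) + 1) *
      fawazKernel (((n : ℝ) + 1) * x)) (Set.Ici (x₀ / 2)) := fun x _ ↦ fawazI_eq_tsum_fawazKernel x
  have h2 : ContinuousOn fawazI (Set.Ici (x₀ / 2)) := hcont.congr heq
  have hmem : Set.Ici (x₀ / 2) ∈ 𝓝 x₀ := Ici_mem_nhds (by simp at hx₀; linarith)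
  exact (h2.continuousAt hmem).continuousWithinAt

/-- `I` is continuous at every `x > 0`. [cite: AndersonStark1981, §4 (17)] -/
theorem continuousAt_fawazI {x : ℝ} (hx : 0 < x) : ContinuousAt fawazI x :=
  continuousOn_fawazI.continuousAt (Ioi_mem_nhds hx)

/-! ## The Mellin transform of `I − 1` converges on `0 < Re s < ½` -/

/-- **Absolute convergence of the Mellin transform of `I − 1`** (Anderson–Stark (19) and the
discussion after it: the transform `∫_0^∞ x^{-w} h(x) dx/x` converges absolutely for
`−½ < Re w < 0`): in Mathlib's convention `mellin f s = ∫_0^∞ t^{s−1} f(t) dt` (`s = −w`),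
`MellinConvergent (I − 1) s` for `0 < Re s < ½`. [cite: AndersonStark1981, §4 (19)] -/
theorem mellinConvergent_fawazI_sub_one {s : ℂ} (hs0 : 0 < s.re) (hs1 : s.re < 1 / 2) :
    MellinConvergent (fun x : ℝ ↦ ((fawazI x - 1 : ℝ) : ℂ)) s := by
  have hd : 0 < min (s.re / 2) (1 / 2) := lt_min (by linarith) (by norm_num)
  refine mellinConvergent_of_isBigO_rpow (a := 1 / 2) (b := min (s.re / 2) (1 / 2)) ?_ ?_ hs1 ?_ ?_
  · refine ContinuousOn.locallyIntegrableOn ?_ measurableSet_Ioi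
    exact Complex.continuous_ofReal.comp_continuousOn (continuousOn_fawazI.sub continuousOn_const)
  · exact Complex.isBigO_ofReal_left.2 fawazI_sub_one_isBigO_atTop
  · exact Complex.isBigO_ofReal_left.2 (fawazI_sub_one_isBigO_nhds_zero hd (min_le_right _ _))
  · exact lt_of_le_of_lt (min_le_left _ _) (by linarith)

end Literature.NumberTheory.LFunctions
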